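import Literature.IUT.HodgeArakelov.LabelClassesOfCusps
import HarnessLib

/-!
# [IUTchII] Cor 2.4 (i), input (B): the closure statement `γ' ∈ Δ̂^±_{v□}` reduced to its finite levels

Mochizuki, *Inter-universal Teichmüller Theory II*, kurims manuscript (Dec. 2020), §2, Cor 2.4 (i), proof, p.70 l.−2 –
p.71 l.3: "Now, by applying the equivalence of [IUTchI], Corollary 2.3, (vi) [cf. also [CombGC], Proposition 1.2, (ii)], to
the various finite index open subgroups of `Δ^±_v`, it follows that `γ' ∈ Δ̂^±_{v□}` — where we use the notation "∧" to
denote the closure in `Δ̂^±_v`" [cite: Mochizuki2012, II Cor 2.4 (i) pp.70–71] (D-0012 claim key, status disputed;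
PROOF-ONLY companion of abc-iut-L6-t1's `LabelClassesOfCusps` — no definition, nothing of the series asserted).

This is the binder `h23vi` of abc-iut-w4-d012's `cor24_i_of_inputs` / `cor24_i'_of_inputs` (GAP-LEDGER row G-w4d012-2:
"an ARGUMENT — cusp-vs-subgraph incidence of Cor 2.3 (vi) for EVERY finite étale cover of `X_v` pins `γ'` modulo every
open subgroup").  The printed sentence has two halves: (a) AT EACH FINITE LEVEL `i` (a finite index open subgroup, i.e. a
finite étale covering, with `U_i ⊆ Π̂^cor_v` the open subgroup acting trivially on the level-`i` dual graph), Cor 2.3 (vi)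
for that covering gives "`γ' ∈ Δ^±_{v□} · U_i`" (the stabiliser of the level-`i` component of the inverse image of the
subgraph `□`); (b) PURE TOPOLOGY: the `U_i` shrink to `1` ("the various finite index open subgroups"), so an element lying
in `Δ^±_{v□} · U_i` for every `i` lies in the closure of `Δ^±_{v□}`.  Half (b) is kernel-checked here
(`mem_closure_of_forall_level`), and `h23vi_of_levelwise` packages it: `h23vi` follows from the LEVELWISE statements (a) —
each a HYPOTHESIS, the exact per-level target that the (not yet typed) "pass to an open subgroup" functoriality of
abc-iut-L5-t1's `StableCurveTemperedData` + [IUTchI] Cor 2.3 (vi) at that level must produce — for ANY family of subgroups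
`U_i` shrinking to `1` (HYPOTHESIS `hbasis`; at the model: the open normal subgroups of the profinite `Π̂^cor_v`, or the
kernels of the actions on the level-`i` dual graphs).  Audit note N2 of abc-iut-w5-d121 on p412701.  HONEST FRAMING: a
deduction between typed statements; typed ≠ proved; nothing here bears on [IUTchIII] Cor 3.12.
-/

namespace Literature.IUT.HodgeArakelov

open Topology
open scoped Pointwise

universe u

/-- **IUTchII:Cor2.4(i)** (kurims p.71 l.1–3, topological half) In a topological group, let `U_i` (`i : ι`) be a family of
subgroups SHRINKING TO `1` (every neighbourhood of `1` contains some `U_i`; e.g. the open normal subgroups of a profinite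
group such as `Π̂^cor_v`, "the various finite index open subgroups").  An element `x` that lies in `K · U_i` for every `i`
lies in the closure of the subgroup `K` ("it follows that `γ' ∈ Δ̂^±_{v□}` — the closure"). PROVED (no normality, openness,
compactness or separation is needed). [claim: Mochizuki2012, status: disputed] -/
theorem mem_closure_of_forall_level {G : Type*} [Group G] [TopologicalSpace G] [ContinuousMul G] {ι : Sort*}
    (U : ι → Subgroup G) (hbasis : ∀ V ∈ 𝓝 (1 : G), ∃ i, (U i : Set G) ⊆ V)
    (K : Subgroup G) {x : G} (hx : ∀ i, ∃ k ∈ K, k⁻¹ * x ∈ U i) :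
    x ∈ closure (K : Set G) := by
  rw [mem_closure_iff_nhds]
  intro V hV
  -- `{u | x * u ∈ V}` is a neighbourhood of `1`
  have hU : {u : G | x * u ∈ V} ∈ 𝓝 (1 : G) := by
    have hc : Continuous fun u : G => x * u := continuous_const.mul continuous_id
    exact hc.continuousAt.preimage_mem_nhds (by simpa using hV)
  obtain ⟨i, hiU⟩ := hbasis _ hU
  obtain ⟨k, hk, hkx⟩ := hx i
  -- `x⁻¹ k = (k⁻¹ x)⁻¹ ∈ U_i`, so `k = x · (x⁻¹ k) ∈ V`
  have hn : x⁻¹ * k ∈ U i := by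
    have := (U i).inv_mem hkx
    rwa [mul_inv_rev, inv_inv] at this
  refine ⟨k, ?_, hk⟩
  have hkV : x * (x⁻¹ * k) ∈ V := hiU hn
  rwa [mul_inv_cancel_left] at hkV

/-- **IUTchII:Cor2.4(i)** (kurims p.71 l.1–3, topological half, open-normal form) In a topological group whose open normal
subgroups form a basis of neighbourhoods of `1` [a profinite group], an element lying in `K · N` for every open normal
subgroup `N` lies in the closure of `K`. PROVED. [claim: Mochizuki2012, status: disputed] -/
theorem mem_closure_of_forall_openNormal {G : Type*} [Group G] [TopologicalSpace G] [ContinuousMul G]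
    (hbasis : ∀ V ∈ 𝓝 (1 : G), ∃ N : Subgroup G, N.Normal ∧ IsOpen (N : Set G) ∧ (N : Set G) ⊆ V)
    (K : Subgroup G) {x : G}
    (hx : ∀ N : Subgroup G, N.Normal → IsOpen (N : Set G) → ∃ k ∈ K, k⁻¹ * x ∈ N) :
    x ∈ closure (K : Set G) :=
  mem_closure_of_forall_level
    (fun N : {N : Subgroup G // N.Normal ∧ IsOpen (N : Set G)} => (N : Subgroup G))
    (fun V hV => by
      obtain ⟨N, hN, hNo, hNV⟩ := hbasis V hV
      exact ⟨⟨N, hN, hNo⟩, hNV⟩)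
    K fun N => hx N N.2.1 N.2.2

namespace PlusMinusTower

variable {S : BadPlaceSetting.{u}} {P : TopGroup.{u}} {T : TemperedCoverings S P} (W : PlusMinusTower T)

/-- **IUTchII:Cor2.4(i)** (kurims p.70 l.−2 – p.71 l.3) **The binder `h23vi` of `cor24_i_of_inputs` from its finite
levels.**  HYPOTHESES: a family of subgroups `U_i ⊆ Π̂^cor_v` shrinking to `1` (`hbasis`; at the model the kernels of the
actions on the level-`i` dual graphs / the open normal subgroups of the profinite `Π̂^cor_v`), and (a) `hlevel` — for every
level `i` and every `γ' ∈ Δ^±_v` with `I^{γ'} ⊆ Π^±_{v□}`: `γ' ∈ Δ^±_{v□} · U_i` (print: "[IUTchI], Corollary 2.3, (vi)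
[cf. also [CombGC], Proposition 1.2, (ii)]" applied to the finite index open subgroup / finite étale covering of level
`i` — NOT proved here; it is the per-level statement the L5 side must supply, GAP-LEDGER G-w4d012-2).  CONCLUSION: for
`γ' ∈ Δ^±_v`, `I^{γ'} ⊆ Π^±_{v□} ⟹ γ' ∈` the closure of `Δ^±_{v□}` — VERBATIM `h23vi`.  PROVED (pure topology).
[claim: Mochizuki2012, status: disputed] -/
theorem h23vi_of_levelwise (H : Subgroup P) (I : Subgroup W.Corhat) {ι : Sort*} (U : ι → Subgroup W.Corhat)
    (hbasis : ∀ V ∈ 𝓝 (1 : W.Corhat), ∃ i, (U i : Set W.Corhat) ⊆ V)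
    (hlevel : ∀ (i : ι) (γ' : W.Corhat), γ' ∈ W.piPM ⊓ W.aug.ker →
      I.map (MulAut.conj γ').toMonoidHom ≤ W.pmBox H → ∃ k ∈ W.deltaPmBox H, k⁻¹ * γ' ∈ U i) :
    ∀ γ' : W.Corhat, γ' ∈ W.piPM ⊓ W.aug.ker →
      I.map (MulAut.conj γ').toMonoidHom ≤ W.pmBox H → γ' ∈ closure (W.deltaPmBox H : Set W.Corhat) :=
  fun γ' hγ' hc =>
    mem_closure_of_forall_level U hbasis (W.deltaPmBox H) fun i => hlevel i γ' hγ' hc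

/-- **IUTchII:Cor2.4(i)** (kurims p.71 l.1–3) The same with the levels indexed by the open normal subgroups of `Π̂^cor_v`
("the various finite index open subgroups"), assumed to form a basis of neighbourhoods of `1` (profiniteness of `Π̂^cor_v`).
PROVED. [claim: Mochizuki2012, status: disputed] -/
theorem h23vi_of_openNormal_levelwise (H : Subgroup P) (I : Subgroup W.Corhat)
    (hbasis : ∀ V ∈ 𝓝 (1 : W.Corhat), ∃ N : Subgroup W.Corhat, N.Normal ∧ IsOpen (N : Set W.Corhat) ∧
      (N : Set W.Corhat) ⊆ V)
    (hlevel : ∀ N : Subgroup W.Corhat, N.Normal → IsOpen (N : Set W.Corhat) →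
      ∀ γ' : W.Corhat, γ' ∈ W.piPM ⊓ W.aug.ker → I.map (MulAut.conj γ').toMonoidHom ≤ W.pmBox H →
        ∃ k ∈ W.deltaPmBox H, k⁻¹ * γ' ∈ N) :
    ∀ γ' : W.Corhat, γ' ∈ W.piPM ⊓ W.aug.ker →
      I.map (MulAut.conj γ').toMonoidHom ≤ W.pmBox H → γ' ∈ closure (W.deltaPmBox H : Set W.Corhat) :=
  fun γ' hγ' hc =>
    mem_closure_of_forall_openNormal hbasis (W.deltaPmBox H) fun N hN hNo => hlevel N hN hNo γ' hγ' hc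

end PlusMinusTower

end Literature.IUT.HodgeArakelov
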